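import Literature.ModelTheory.ExponentialFields.DefinablyCompleteInverseRegularity
import Literature.ModelTheory.ExponentialFields.DefinablyCompleteChainRule
import Literature.ModelTheory.ExponentialFields.DefinablyCompactUniformContinuity
import HarnessLib

/-!
# The inverse function theorem over a definably complete ordered field, IV: the `C¹` statement

Topic `Literature/ModelTheory/ExponentialFields`.  The classical local inverse function
theorem for `C¹` definable maps `F : Kⁿ → Kⁿ` over a definably complete ordered field `K`
(Fornasiero–Servi 2010, §1.2; van den Dries 1998, Ch. 7, §2), assembled from parts I–III
(`DefinablyCompleteInverseFunction.lean`, `DefinablyCompleteLocalInverse.lean`,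
`DefinablyCompleteInverseRegularity.lean`) by the linear change of coordinates `G₀ = P · F`,
`P = J(a)⁻¹`:

* `HasLinDerivAt.sum`, `HasLinDerivAt.comp_linear` — finite sums, and composition with a
  linear map `y ↦ A y`, for the norm-free differentiability predicate;
* `of_mul_of_eq_one_iff`, `two_sided_inverse_of_conjugate` — matrix bookkeeping: if `P` is a
  two-sided inverse of `J(a)` and `Q` one of `P · J`, then `Q · P` is one of `J`;
* **`IsDefinablyComplete.exists_localInverse_of_jacobian`** — let `F` be definable and `C¹` on
  the open sup-ball of radius `ρ` around `a` (continuous components, partial derivatives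
  `J x i j` continuous there) and let `P` be a two-sided inverse of the Jacobian `J a`.  Then
  there are `r ∈ (0, ρ)`, `c > 0` and a definable `G : Kⁿ → Kⁿ` such that, with
  `U = {|x - a|_∞ < r}` and `V = {|y - F a|_∞ < c}`: `G` maps `V` into `U` with `F (G y) = y`;
  `G (F x) = x` for `x ∈ U` with `F x ∈ V`; `G` is Lipschitz on `V`; and at every `y ∈ V`
  the Jacobian `J (G y)` has a two-sided inverse and each component `G · i` is differentiable
  at `y` with gradient the `i`-th row of *any* right inverse of `J (G y)`.

Everything is proved; no definitions, no named facts.  Conventions as in parts I–III.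

## References

* A. Fornasiero, T. Servi, *Definably complete Baire structures*, Fund. Math. 209 (2010),
  §1.2. [FornasieroServi2010]
* L. van den Dries, *Tame topology and o-minimal structures* (1998), Ch. 7, §2.
  [Dries1998]
-/

open Set Function FirstOrder FirstOrder.Language
open _root_.Filter _root_.Topology

namespace Literature.ModelTheory.ExponentialFields

universe u v

variable {K : Type*} [Field K] [LinearOrder K] [IsStrictOrderedRing K] [TopologicalSpace K]
  [OrderTopology K] {L : FirstOrder.Language.{u, v}} [L.Structure K] {n : ℕ}

/-! ### Calculus preliminaries -/

omit [TopologicalSpace K] [OrderTopology K] [L.Structure K] in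
/-- Finite sums of differentiable functions on `Kⁿ`. [folklore] -/
theorem HasLinDerivAt.sum {ι : Type*} (s : Finset ι) {f : ι → (Fin n → K) → K}
    {g : ι → Fin n → K} {x : Fin n → K} (h : ∀ k ∈ s, HasLinDerivAt (f k) (g k) x) :
    HasLinDerivAt (fun y => ∑ k ∈ s, f k y) (∑ k ∈ s, g k) x := by
  classical
  induction s using Finset.induction_on with
  | empty => simpa using hasLinDerivAt_const (0 : K) x
  | insert a s ha ih =>
      have h1 := (h a (Finset.mem_insert_self a s)).add
        (ih fun k hk => h k (Finset.mem_insert_of_mem hk))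
      simpa only [Finset.sum_insert ha] using h1

omit [TopologicalSpace K] [OrderTopology K] [L.Structure K] in
/-- **Composition with a linear map**: if `f` is differentiable at `A y₀` (where
`(A y)ᵢ = Σⱼ Aᵢⱼ yⱼ`) with gradient `g`, then `y ↦ f (A y)` is differentiable at `y₀` with
gradient `(Σᵢ gᵢ Aᵢⱼ)ⱼ`. [folklore] -/
theorem HasLinDerivAt.comp_linear {m : ℕ} {f : (Fin n → K) → K} {g : Fin n → K}
    (A : Fin n → Fin m → K) {y₀ : Fin m → K}
    (hf : HasLinDerivAt f g (fun i => ∑ j, A i j * y₀ j)) :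
    HasLinDerivAt (fun y => f (fun i => ∑ j, A i j * y j)) (fun j => ∑ i, g i * A i j) y₀ := by
  classical
  intro ε hε
  set C : K := ∑ i, ∑ j, |A i j| with hC
  have hC0 : 0 ≤ C := Finset.sum_nonneg fun i _ => Finset.sum_nonneg fun j _ => abs_nonneg _
  have hC1 : 0 < C + 1 := by linarith
  obtain ⟨δ, hδ, hfδ⟩ := hf (ε / (C + 1)) (div_pos hε hC1)
  refine ⟨δ / (C + 1), div_pos hδ hC1, fun h hh => ?_⟩
  have hrow : ∀ i, ∑ j, |A i j| ≤ C := fun i =>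
    Finset.single_le_sum (f := fun i => ∑ j, |A i j|)
      (fun i _ => Finset.sum_nonneg fun j _ => abs_nonneg _) (Finset.mem_univ i)
  set S : K := ∑ j, |h j| with hS
  have hS0 : 0 ≤ S := Finset.sum_nonneg fun j _ => abs_nonneg _
  set Ah : Fin n → K := fun i => ∑ j, A i j * h j with hAh
  -- `|Ah i| < δ`
  have hAh_lt : ∀ i, |Ah i| < δ := by
    intro i
    have h1 : |Ah i| ≤ (∑ j, |A i j|) * (δ / (C + 1)) :=
      abs_sum_mul_le_sum_abs_mul (A i) h fun j => (hh j).le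
    have h2 : (∑ j, |A i j|) * (δ / (C + 1)) ≤ C * (δ / (C + 1)) :=
      mul_le_mul_of_nonneg_right (hrow i) (div_pos hδ hC1).le
    have h3 : C * (δ / (C + 1)) < δ := by
      rw [mul_div_assoc', div_lt_iff₀ hC1]
      nlinarith
    exact lt_of_le_of_lt (h1.trans h2) h3
  -- `|Ah i| ≤ (Σⱼ |A i j|) S`
  have hAh_le : ∀ i, |Ah i| ≤ (∑ j, |A i j|) * S := fun i =>
    abs_sum_mul_le_sum_abs_mul (A i) h fun j =>
      Finset.single_le_sum (f := fun j => |h j|) (fun j _ => abs_nonneg _) (Finset.mem_univ j)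
  have hmain := hfδ Ah hAh_lt
  -- `A (y₀ + h) = A y₀ + Ah`, and the gradient sum
  have hlin : (fun i => ∑ j, A i j * (y₀ + h) j) = (fun i => ∑ j, A i j * y₀ j) + Ah := by
    funext i
    simp only [hAh, Pi.add_apply, mul_add, Finset.sum_add_distrib]
  have hgrad : ∑ j, (∑ i, g i * A i j) * h j = ∑ i, g i * Ah i := by
    simp only [hAh, Finset.mul_sum, Finset.sum_mul]
    rw [Finset.sum_comm]
    exact Finset.sum_congr rfl fun i _ => Finset.sum_congr rfl fun j _ => by ring
  show |f (fun i => ∑ j, A i j * (y₀ + h) j) - f (fun i => ∑ j, A i j * y₀ j) -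
      ∑ j, (∑ i, g i * A i j) * h j| ≤ ε * S
  rw [hlin, hgrad]
  calc |f ((fun i => ∑ j, A i j * y₀ j) + Ah) - f (fun i => ∑ j, A i j * y₀ j) -
        ∑ i, g i * Ah i| ≤ ε / (C + 1) * ∑ i, |Ah i| := hmain
    _ ≤ ε / (C + 1) * (C * S) := by
        refine mul_le_mul_of_nonneg_left ?_ (div_pos hε hC1).le
        calc ∑ i, |Ah i| ≤ ∑ i, (∑ j, |A i j|) * S := Finset.sum_le_sum fun i _ => hAh_le i
          _ = C * S := by rw [hC, Finset.sum_mul]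
    _ ≤ ε * S := by
        rw [div_mul_eq_mul_div, div_le_iff₀ hC1]
        nlinarith [mul_nonneg hε.le hS0]

/-! ### Matrix bookkeeping -/

omit [LinearOrder K] [IsStrictOrderedRing K] [TopologicalSpace K] [OrderTopology K]
  [L.Structure K] in
/-- `of A * of B = 1` in entries. [folklore] -/
theorem of_mul_of_eq_one_iff {A B : Fin n → Fin n → K} :
    Matrix.of A * Matrix.of B = 1 ↔ ∀ i j, ∑ k, A i k * B k j = if i = j then 1 else 0 := by
  classical
  constructor
  · intro h i j
    have h1 := congr_fun (congr_fun h i) j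
    rw [Matrix.mul_apply, Matrix.one_apply] at h1
    simpa using h1
  · intro h
    ext i j
    rw [Matrix.mul_apply, Matrix.one_apply]
    simpa using h i j

omit [LinearOrder K] [IsStrictOrderedRing K] [TopologicalSpace K] [OrderTopology K]
  [L.Structure K] in
/-- The entrywise product as a product of `Matrix.of`s. [folklore] -/
theorem of_sum_mul_eq_of_mul_of (A B : Fin n → Fin n → K) :
    Matrix.of (fun i j => ∑ k, A i k * B k j) = Matrix.of A * Matrix.of B := by
  ext i j
  rw [Matrix.mul_apply]
  simp

omit [LinearOrder K] [IsStrictOrderedRing K] [TopologicalSpace K] [OrderTopology K]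
  [L.Structure K] in
/-- **Inverse of a conjugate**: if `P` is a right inverse of `Ja` (`Ja P = 1`) and `Q` a
two-sided inverse of `P · J`, then `Q · P` is a two-sided inverse of `J`. [folklore] -/
theorem two_sided_inverse_of_conjugate {Ja P J Q : Fin n → Fin n → K}
    (hJaP : ∀ i j, ∑ k, Ja i k * P k j = if i = j then 1 else 0)
    (hQM : ∀ i j, ∑ k, Q i k * (∑ l, P k l * J l j) = if i = j then 1 else 0)
    (hMQ : ∀ i j, ∑ k, (∑ l, P i l * J l k) * Q k j = if i = j then 1 else 0) :
    (∀ i j, ∑ k, (∑ l, Q i l * P l k) * J k j = if i = j then 1 else 0) ∧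
      (∀ i j, ∑ k, J i k * (∑ l, Q k l * P l j) = if i = j then 1 else 0) := by
  classical
  have h2 : Matrix.of Ja * Matrix.of P = 1 := of_mul_of_eq_one_iff.2 hJaP
  have h3 : Matrix.of Q * (Matrix.of P * Matrix.of J) = 1 := by
    rw [← of_sum_mul_eq_of_mul_of P J]; exact of_mul_of_eq_one_iff.2 hQM
  have h4 : (Matrix.of P * Matrix.of J) * Matrix.of Q = 1 := by
    rw [← of_sum_mul_eq_of_mul_of P J]; exact of_mul_of_eq_one_iff.2 hMQ
  have hQP : Matrix.of (fun i k => ∑ l, Q i l * P l k) = Matrix.of Q * Matrix.of P :=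
    of_sum_mul_eq_of_mul_of Q P
  constructor
  · refine of_mul_of_eq_one_iff.1 ?_
    rw [hQP, Matrix.mul_assoc]
    exact h3
  · refine of_mul_of_eq_one_iff.1 ?_
    rw [hQP]
    have hJ : Matrix.of J = Matrix.of Ja * (Matrix.of P * Matrix.of J) := by
      rw [← Matrix.mul_assoc, h2, Matrix.one_mul]
    calc Matrix.of J * (Matrix.of Q * Matrix.of P)
        = Matrix.of Ja * ((Matrix.of P * Matrix.of J) * Matrix.of Q) * Matrix.of P := by
          conv_lhs => rw [hJ]
          simp only [Matrix.mul_assoc]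
      _ = 1 := by rw [h4, Matrix.mul_one, h2]

omit [LinearOrder K] [IsStrictOrderedRing K] [TopologicalSpace K] [OrderTopology K]
  [L.Structure K] in
/-- A left inverse equals any right inverse. [folklore] -/
theorem left_inverse_eq_right_inverse {D J R : Fin n → Fin n → K}
    (hDJ : ∀ i j, ∑ k, D i k * J k j = if i = j then 1 else 0)
    (hJR : ∀ i j, ∑ k, J i k * R k j = if i = j then 1 else 0) : D = R := by
  classical
  have h1 : Matrix.of D * Matrix.of J = 1 := of_mul_of_eq_one_iff.2 hDJ
  have h2 : Matrix.of J * Matrix.of R = 1 := of_mul_of_eq_one_iff.2 hJR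
  have h : Matrix.of D = Matrix.of R := by
    calc Matrix.of D = Matrix.of D * (Matrix.of J * Matrix.of R) := by rw [h2, Matrix.mul_one]
      _ = Matrix.of R := by rw [← Matrix.mul_assoc, h1, Matrix.one_mul]
  funext i j
  have := congr_fun (congr_fun h i) j
  simpa using this

/-! ### The `C¹` inverse function theorem -/

/-- From pointwise continuity to the sup-ball form used by
`hasLinDerivAt_of_continuous_partial`. [folklore] -/
theorem exists_forall_abs_sub_le_of_continuousAt {m : ℕ} {p : (Fin m → K) → K} {x : Fin m → K}
    (hp : ContinuousAt p x) (ε : K) (hε : 0 < ε) :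
    ∃ δ : K, 0 < δ ∧ ∀ w : Fin m → K, (∀ j, |w j - x j| < δ) → |p w - p x| ≤ ε := by
  have hev : ∀ᶠ w in 𝓝 x, |p w - p x| < ε := (LinearOrderedAddCommGroup.tendsto_nhds.1 hp) ε hε
  obtain ⟨δ, hδ, hδt⟩ := exists_pos_forall_abs_sub_lt_subset_of_mem_nhds hev
  exact ⟨δ, hδ, fun w hw => le_of_lt (hδt w hw)⟩
set_option maxHeartbeats 400000 in -- buildfix (bf3-g26): 160k/180k FAIL, 200k PASS at accept time; line-neutral budget line
/-- **The local inverse function theorem for `C¹` definable maps** over a definably complete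
ordered field: see the module docstring. [folklore] -/
theorem _root_.FirstOrder.Language.IsDefinablyComplete.exists_localInverse_of_jacobian
    (hDC : L.IsDefinablyComplete K)
    (hlt : (univ : Set K).Definable L {v : Fin 2 → K | v 0 < v 1})
    (hadd : (univ : Set K).Definable L {v : Fin 3 → K | v 2 = v 0 + v 1})
    (hmul : (univ : Set K).Definable L {v : Fin 3 → K | v 2 = v 0 * v 1})
    {F : (Fin n → K) → Fin n → K} (hF : ∀ i, (univ : Set K).DefinableFun L fun x => F x i)
    {J : (Fin n → K) → Fin n → Fin n → K} {a : Fin n → K} {ρ : K} (hρ : 0 < ρ)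
    (hcont : ∀ i, ContinuousOn (fun x => F x i) {x | ∀ j, |x j - a j| < ρ})
    (hder : ∀ x : Fin n → K, (∀ j, |x j - a j| < ρ) →
      ∀ i j, HasPartialDerivAt (fun z => F z i) j (J x i j) x)
    (hJc : ∀ x : Fin n → K, (∀ j, |x j - a j| < ρ) → ∀ i j, ContinuousAt (fun z => J z i j) x)
    {P : Fin n → Fin n → K} (hPJ : ∀ i j, ∑ k, P i k * J a k j = if i = j then 1 else 0)
    (hJP : ∀ i j, ∑ k, J a i k * P k j = if i = j then 1 else 0) :
    ∃ r c : K, 0 < r ∧ r < ρ ∧ 0 < c ∧ ∃ G : (Fin n → K) → Fin n → K,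
      (∀ i, (univ : Set K).DefinableFun L fun y => G y i) ∧
      (∀ y : Fin n → K, (∀ i, |y i - F a i| < c) → (∀ j, |G y j - a j| < r) ∧ F (G y) = y) ∧
      (∀ x : Fin n → K, (∀ j, |x j - a j| < r) → (∀ i, |F x i - F a i| < c) → G (F x) = x) ∧
      (∃ Λ : K, ∀ y y' : Fin n → K, (∀ i, |y i - F a i| < c) → (∀ i, |y' i - F a i| < c) →
        ∀ μ : K, (∀ k, |y k - y' k| ≤ μ) → ∀ j, |G y j - G y' j| ≤ Λ * μ) ∧
      (∀ y : Fin n → K, (∀ i, |y i - F a i| < c) →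
        (∃ R : Fin n → Fin n → K, (∀ i j, ∑ k, R i k * J (G y) k j = if i = j then 1 else 0) ∧
            (∀ i j, ∑ k, J (G y) i k * R k j = if i = j then 1 else 0)) ∧
        ∀ R : Fin n → Fin n → K, (∀ i j, ∑ k, J (G y) i k * R k j = if i = j then 1 else 0) →
          ∀ i, HasLinDerivAt (fun y' => G y' i) (R i) y) := by
  classical
  rcases isEmpty_or_nonempty (Fin n) with hn | hn
  · -- `n = 0`
    refine ⟨ρ / 2, 1, half_pos hρ, half_lt_self hρ, one_pos, fun _ => a,
      fun i => (hn.false i).elim, fun y _ => ⟨fun j => (hn.false j).elim, funext fun i => (hn.false i).elim⟩,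
      fun x _ _ => funext fun j => (hn.false j).elim, ⟨0, fun y y' _ _ μ _ j => (hn.false j).elim⟩,
      fun y _ => ⟨⟨P, fun i => (hn.false i).elim, fun i => (hn.false i).elim⟩,
        fun R _ i => (hn.false i).elim⟩⟩
  -- constants (as in part II)
  have hn0 : (0 : K) < n := by
    have : 0 < n := Fin.pos_iff_nonempty.2 hn
    exact_mod_cast this
  have hn1 : (1 : K) ≤ n := by
    have : 1 ≤ n := Nat.one_le_iff_ne_zero.2 (Fin.pos_iff_nonempty.2 hn).ne'
    exact_mod_cast this
  set η : K := 1 / (2 * n + 2) with hη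
  have hηpos : 0 < η := by rw [hη]; positivity
  have h2nη : 2 * (n : K) * η ≤ 1 := by
    rw [hη, mul_one_div, div_le_one (by positivity)]
    linarith
  set SP : K := ∑ i, ∑ k, |P i k| with hSP
  have hSP0 : 0 ≤ SP := Finset.sum_nonneg fun i _ => Finset.sum_nonneg fun k _ => abs_nonneg _
  have hSP1 : 0 < SP + 1 := by linarith
  have hrow : ∀ i, ∑ k, |P i k| ≤ SP := fun i =>
    Finset.single_le_sum (f := fun i => ∑ k, |P i k|)
      (fun i _ => Finset.sum_nonneg fun k _ => abs_nonneg _) (Finset.mem_univ i)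
  set ε : K := η / (SP + 1) with hε
  have hεpos : 0 < ε := div_pos hηpos hSP1
  -- a common radius for the continuity of the entries of `J` at `a`
  have ha0 : ∀ j, |a j - a j| < ρ := fun j => by simpa using hρ
  have hδ : ∀ p : Fin n × Fin n, ∃ δ : K, 0 < δ ∧ ∀ x : Fin n → K, (∀ k, |x k - a k| < δ) →
      |J x p.1 p.2 - J a p.1 p.2| ≤ ε := fun p =>
    exists_forall_abs_sub_le_of_continuousAt (hJc a ha0 p.1 p.2) ε hεpos
  choose δ hδpos hδ using hδ
  have hne : (Finset.univ : Finset (Fin n × Fin n)).Nonempty := Finset.univ_nonempty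
  set δ₀ : K := Finset.univ.inf' hne δ with hδ₀
  have hδ₀pos : 0 < δ₀ := (Finset.lt_inf'_iff _).2 fun p _ => hδpos p
  have hδ₀le : ∀ p, δ₀ ≤ δ p := fun p => Finset.inf'_le _ (Finset.mem_univ p)
  set r : K := min (ρ / 2) (δ₀ / 2) with hr
  have hrpos : 0 < r := lt_min (half_pos hρ) (half_pos hδ₀pos)
  have hrρ : r < ρ := (min_le_left _ _).trans_lt (half_lt_self hρ)
  have hrδ : ∀ p, r < δ p := fun p =>
    ((min_le_right _ _).trans_lt (half_lt_self hδ₀pos)).trans_le (hδ₀le p)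
  -- the closed `r`-box `B`
  set B : Set (Fin n → K) := {x | ∀ j, a j - r ≤ x j ∧ x j ≤ a j + r} with hB
  have hBρ : ∀ x ∈ B, ∀ j, |x j - a j| < ρ := fun x hx j =>
    lt_of_le_of_lt (abs_le.2 ⟨by linarith [(hx j).1], by linarith [(hx j).2]⟩) hrρ
  have hBδ : ∀ x ∈ B, ∀ p, ∀ k, |x k - a k| < δ p := fun x hx p k =>
    lt_of_le_of_lt (abs_le.2 ⟨by linarith [(hx k).1], by linarith [(hx k).2]⟩) (hrδ p)
  have hopenB : ∀ x : Fin n → K, (∀ j, |x j - a j| < r) → x ∈ B := fun x hx j =>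
    ⟨by linarith [(abs_lt.1 (hx j)).1], by linarith [(abs_lt.1 (hx j)).2]⟩
  -- `G₀ = P · F` and its Jacobian `HG = P · J`
  set G₀ : (Fin n → K) → Fin n → K := fun x i => ∑ k, P i k * F x k with hG₀
  set HG : (Fin n → K) → Fin n → Fin n → K := fun x i j => ∑ k, P i k * J x k j with hHG
  have hPdef : (univ : Set K).DefinableMap L
      fun (y : Fin n → K) (k : Fin n) => ∑ l, P k l * y l := by
    intro k
    refine definableFun_sum hadd Finset.univ fun l _ => ?_
    exact definableFun_apply₂_params hmul (definableFun_const_params _ (mem_univ (P k l)))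
      (definableFun_proj_params l)
  have hG₀def : ∀ i, (univ : Set K).DefinableFun L fun x => G₀ x i := by
    intro i
    refine definableFun_sum hadd Finset.univ fun k _ => ?_
    exact definableFun_apply₂_params hmul (definableFun_const_params _ (mem_univ (P i k))) (hF k)
  have hG₀der : ∀ x ∈ B, ∀ i j, HasPartialDerivAt (fun z => G₀ z i) j (HG x i j) x := by
    intro x hx i j
    rw [hasPartialDerivAt_iff]
    refine HasFieldDerivAt.sum (Finset.univ : Finset (Fin n))
      (f := fun k t => P i k * F (update x j t) k) (f' := fun k => P i k * J x k j) (x := x j)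
      fun k _ => ?_
    have h := hder x (hBρ x hx) k j
    rw [hasPartialDerivAt_iff] at h
    exact h.const_mul (P i k)
  have hG₀J : ∀ x ∈ B, ∀ i j, |HG x i j - if i = j then 1 else 0| ≤ η := by
    intro x hx i j
    have hdiff : HG x i j - (if i = j then 1 else 0) = ∑ k, P i k * (J x k j - J a k j) := by
      rw [← hPJ i j, hHG]
      simp only [mul_sub, Finset.sum_sub_distrib]
    rw [hdiff]
    calc |∑ k, P i k * (J x k j - J a k j)| ≤ (∑ k, |P i k|) * ε :=
          abs_sum_mul_le_sum_abs_mul (P i) (fun k => J x k j - J a k j)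
            fun k => hδ (k, j) x (hBδ x hx (k, j))
      _ ≤ SP * ε := mul_le_mul_of_nonneg_right (hrow i) hεpos.le
      _ ≤ (SP + 1) * ε := mul_le_mul_of_nonneg_right (by linarith) hεpos.le
      _ = η := by rw [hε, mul_div_cancel₀ _ hSP1.ne']
  have hG₀cont : ∀ i, ContinuousOn (fun x => G₀ x i) B := by
    intro i
    refine continuousOn_finsetSum _ fun k _ => ?_
    exact continuousOn_const.mul ((hcont k).mono fun x hx => hBρ x hx)
  -- part III for `G₀`: a definable local inverse `H`
  obtain ⟨H, hHdef, hHW, hHinv, hHLip⟩ := hDC.exists_localInverse_of_jacobian_near_one hlt hadd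
    hmul hG₀def h2nη hrpos hG₀cont (fun x hx => hG₀der x hx) (fun x hx => hG₀J x hx)
  -- radius of the sup-ball `W₀` around `G₀ a`, and the estimate `|P v|_∞ ≤ SP |v|_∞`
  set R₀ : K := r / (4 * n) with hR₀
  have hR₀pos : 0 < R₀ := div_pos hrpos (by positivity)
  have hPest : ∀ v : Fin n → K, ∀ μ : K, (∀ k, |v k| ≤ μ) → ∀ i, |∑ k, P i k * v k| ≤ SP * μ := by
    intro v μ hv i
    have hμ : 0 ≤ μ := (abs_nonneg _).trans (hv (Classical.arbitrary (Fin n)))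
    exact (abs_sum_mul_le_sum_abs_mul (P i) v hv).trans (mul_le_mul_of_nonneg_right (hrow i) hμ)
  -- `c`: `|y - F a|_∞ < c` implies `|P y - G₀ a|_∞ < R₀`
  set c : K := R₀ / (SP + 1) with hc
  have hcpos : 0 < c := div_pos hR₀pos hSP1
  have hPyW : ∀ y : Fin n → K, (∀ i, |y i - F a i| < c) →
      ∀ i, |(∑ k, P i k * y k) - G₀ a i| < R₀ := by
    intro y hy i
    obtain ⟨k₀, -, hk₀⟩ :=
      Finset.exists_max_image Finset.univ (fun k => |y k - F a k|) Finset.univ_nonempty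
    have hdiff : (∑ k, P i k * y k) - G₀ a i = ∑ k, P i k * (y k - F a k) := by
      simp only [hG₀, mul_sub, Finset.sum_sub_distrib]
    rw [hdiff]
    have h1 := hPest (fun k => y k - F a k) |y k₀ - F a k₀| (fun k => hk₀ k (Finset.mem_univ k)) i
    have h2 : SP * |y k₀ - F a k₀| ≤ (SP + 1) * |y k₀ - F a k₀| :=
      mul_le_mul_of_nonneg_right (by linarith) (abs_nonneg _)
    have h3 : (SP + 1) * |y k₀ - F a k₀| < (SP + 1) * c := mul_lt_mul_of_pos_left (hy k₀) hSP1
    have h4 : (SP + 1) * c = R₀ := by rw [hc, mul_div_cancel₀ _ hSP1.ne']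
    linarith
  -- the inverse `G y = H (P y)`
  set G : (Fin n → K) → Fin n → K := fun y => H fun i => ∑ k, P i k * y k with hG
  -- `F ∘ G = id` on `V`
  have hFG : ∀ y : Fin n → K, (∀ i, |y i - F a i| < c) → (∀ j, |G y j - a j| < r) ∧ F (G y) = y := by
    intro y hy
    have h := hHW (fun i => ∑ k, P i k * y k) (hPyW y hy)
    refine ⟨h.1, funext fun i => ?_⟩
    have h2 : ∀ l, ∑ k, P l k * F (G y) k = ∑ k, P l k * y k := fun l => by
      have := congr_fun h.2 l
      simpa only [hG₀] using this
    calc F (G y) i = ∑ l, J a i l * ∑ k, P l k * F (G y) k :=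
          (sum_mul_sum_mul_eq_of_mul_eq_one hJP (F (G y)) i).symm
      _ = ∑ l, J a i l * ∑ k, P l k * y k := by simp only [h2]
      _ = y i := sum_mul_sum_mul_eq_of_mul_eq_one hJP y i
  refine ⟨r, c, hrpos, hrρ, hcpos, G, ?_, hFG, ?_, ?_, ?_⟩
  · -- definability
    intro i
    exact (hHdef i).comp hPdef
  · -- `G ∘ F = id` on `U ∩ F⁻¹ V`
    intro x hx hFx
    have hW : ∀ i, |G₀ x i - G₀ a i| < R₀ := by
      intro i
      have := hPyW (F x) hFx i
      simpa only [hG₀] using this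
    have h := hHinv x hx hW
    simpa only [hG, hG₀] using h
  · -- Lipschitz bound with `Λ = 2 SP`
    refine ⟨2 * SP, fun y y' hy hy' μ hμ j => ?_⟩
    have h := hHLip (fun i => ∑ k, P i k * y k) (fun i => ∑ k, P i k * y' k) (hPyW y hy)
      (hPyW y' hy') (SP * μ) (fun i => ?_) j
    · simpa only [hG, mul_assoc] using h
    · have hdiff : (∑ k, P i k * y k) - ∑ k, P i k * y' k = ∑ k, P i k * (y k - y' k) := by
        simp only [mul_sub, Finset.sum_sub_distrib]
      rw [hdiff]
      exact hPest (fun k => y k - y' k) μ hμ i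
  · -- differentiability at `y ∈ V`
    intro y hy
    set w₀ : Fin n → K := fun i => ∑ k, P i k * y k with hw₀
    have hw₀W : ∀ i, |w₀ i - G₀ a i| < R₀ := hPyW y hy
    set x₀ : Fin n → K := G y with hx₀
    have hx₀r : ∀ j, |x₀ j - a j| < r := (hFG y hy).1
    have hx₀B : x₀ ∈ B := hopenB x₀ hx₀r
    have hx₀ρ : ∀ j, |x₀ j - a j| < ρ := hBρ x₀ hx₀B
    -- `F` is differentiable at `x₀` (continuous partials)
    have hρ' : 0 < ρ - r := by linarith
    have hball : ∀ w : Fin n → K, (∀ j, |w j - x₀ j| < ρ - r) → ∀ j, |w j - a j| < ρ := by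
      intro w hw j
      calc |w j - a j| = |(w j - x₀ j) + (x₀ j - a j)| := by ring_nf
        _ ≤ |w j - x₀ j| + |x₀ j - a j| := abs_add_le _ _
        _ < (ρ - r) + r := add_lt_add (hw j) (hx₀r j)
        _ = ρ := by ring
    have hFd : ∀ i, HasLinDerivAt (fun x => F x i) (fun j => J x₀ i j) x₀ := by
      intro i
      refine hDC.hasLinDerivAt_of_continuous_partial hlt hadd hmul (hF i)
        (p := fun j w => J w i j) hρ' (fun w hw j => hder w (hball w hw) i j) fun j ε' hε' => ?_
      exact exists_forall_abs_sub_le_of_continuousAt (hJc x₀ hx₀ρ i j) ε' hε'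
    -- `G₀` is differentiable at `x₀` with Jacobian `M = P · J x₀ = HG x₀`
    have hG₀d : ∀ l, HasLinDerivAt (fun x => G₀ x l) (HG x₀ l) x₀ := by
      intro l
      have h := HasLinDerivAt.sum (Finset.univ : Finset (Fin n))
        (f := fun k x => P l k * F x k) (g := fun k j => P l k * J x₀ k j) (x := x₀)
        fun k _ => (hFd k).const_mul (P l k)
      have hgr : HG x₀ l = ∑ k ∈ Finset.univ, (fun j => P l k * J x₀ k j) := by
        funext j; simp only [hHG, Finset.sum_apply]
      rw [hgr]
      exact h
    obtain ⟨Q, hQM, hMQ⟩ := exists_two_sided_inverse_of_near_one h2nη (hG₀J x₀ hx₀B)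
    -- part III: `H` is differentiable at `w₀`, gradient rows of `Q`
    have hρw : 0 < R₀ - Finset.univ.sup' Finset.univ_nonempty (fun i => |w₀ i - G₀ a i|) := by
      have : Finset.univ.sup' Finset.univ_nonempty (fun i => |w₀ i - G₀ a i|) < R₀ :=
        (Finset.sup'_lt_iff _).2 fun i _ => hw₀W i
      linarith
    set ρw : K := R₀ - Finset.univ.sup' Finset.univ_nonempty (fun i => |w₀ i - G₀ a i|) with hρw'
    have hballW : ∀ w : Fin n → K, (∀ k, |w k - w₀ k| < ρw) → ∀ i, |w i - G₀ a i| < R₀ := by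
      intro w hw i
      have hle : |w₀ i - G₀ a i| ≤ Finset.univ.sup' Finset.univ_nonempty (fun i => |w₀ i - G₀ a i|) :=
        Finset.le_sup' (fun i => |w₀ i - G₀ a i|) (Finset.mem_univ i)
      calc |w i - G₀ a i| = |(w i - w₀ i) + (w₀ i - G₀ a i)| := by ring_nf
        _ ≤ |w i - w₀ i| + |w₀ i - G₀ a i| := abs_add_le _ _
        _ < ρw + Finset.univ.sup' Finset.univ_nonempty (fun i => |w₀ i - G₀ a i|) :=
            add_lt_add_of_lt_of_le (hw i) hle
        _ = R₀ := by rw [hρw']; ring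
    have hHd : ∀ i, HasLinDerivAt (fun w => H w i) (Q i) w₀ := by
      intro i
      refine HasLinDerivAt.localInverse (F := G₀) (M := HG x₀) hρw (fun w hw => (hHW w (hballW w hw)).2)
        (fun w hw μ hμ j => hHLip w w₀ (hballW w hw) hw₀W μ hμ j) ?_ hQM i
      intro l
      have hx₀' : H w₀ = x₀ := by simp only [hx₀, hG, hw₀]
      rw [hx₀']
      exact hG₀d l
    -- `G = H ∘ P`: gradient rows `D = Q · P`, a two-sided inverse of `J x₀`
    set D : Fin n → Fin n → K := fun i j => ∑ l, Q i l * P l j with hD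
    have hGd : ∀ i, HasLinDerivAt (fun y' => G y' i) (D i) y := by
      intro i
      have h := (hHd i).comp_linear P (y₀ := y)
      simpa only [hG, hD] using h
    have hDinv := two_sided_inverse_of_conjugate (Ja := J a) (P := P) (J := J x₀) (Q := Q) hJP
      (fun i j => by simpa only [hHG] using hQM i j) (fun i j => by simpa only [hHG] using hMQ i j)
    refine ⟨⟨D, hDinv.1, hDinv.2⟩, fun R hR i => ?_⟩
    have hDR : D = R := left_inverse_eq_right_inverse hDinv.1 hR
    rw [← hDR]
    exact hGd i

end Literature.ModelTheory.ExponentialFields
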